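import Summits.BirchSwinnertonDyer.BirchSwinnertonDyer.Theorems.PrintCf2SplitBadTwoWildQuadraticRamification
import Summits.BirchSwinnertonDyer.BirchSwinnertonDyer.Theorems.PrintCf2SplitBadTwoFrameFieldArithmetic
import Literature.NumberTheory.NumberFields.EvenValuationSquare
import Literature.NumberTheory.EllipticCurves.MasserWustholzTwistBoundProofs
import HarnessLib

/-!
# Crux `PrintCf2.SplitBadTwoRankOneOfFacts` (stmt-BirchSwinnertonDyer-20368), road α v10.2 — brick B15 §2, file 3:
# THE FIRST LAYER OF EVERY `ℤ₂`-LINE OF THE FRAME FIELD UNRAMIFIED OUTSIDE `v̄` IS `K(√−β)` — no class field theory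

Cell `bsd-print-cf2`, width seat `bsd-line-cf2-p1-w6` g2 (prover-bsd-line-cf2-p1-w6-g2-0); `--supports stmt-BirchSwinnertonDyer-20368`
(helper, Theses-free). HONEST FRAMING: nothing here closes the crux or a registered stub; BSD is not proved by any of this; no summit
statement is proved by this seat. No definition, no named fact, no `sorry`.

WHAT. Memo B15 §1 (C2) (-w2 g9) computes, BY CLASS FIELD THEORY, the first layer `K₁` of the `ℤ₂`-line `K*_∞` of `K = ℚ(√−7)` unramified
outside `v̄`: `K₁ = K(√−ᾱ₀)`, `ᾱ₀` the generator of `v̄`. This file PROVES it for EVERY `ℤ₂`-extension `κ` of the frame field unramified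
outside `v̄` (so for the line of S3c₂, which is quantified over all of them), with no class-field-theoretic input — Kummer theory, `h_K = 1`,
`w_K = 2`, and the wild lemma of file 2:
* §1 the frame field `K` (imaginary quadratic, `θ² = −7`): `d_K = −7`, `h_K = 1` (PID), `w_K = 2`, so **every unit of `𝓞_K` is `±1`**
  (`units_eq_one_or_eq_neg_one`), and the integer `α = (1 + θ)/2` with `α(1 − α) = 2` gives a generator `β ∈ {α, 1 − α}` of `v̄`
  (`exists_mul_one_sub_eq_two_mem`);
* §2 valuations on a frame (member `C • W = cm7^{(d)}` only feeds `e(v∣2) = e(v̄∣2) = 1`, -w3 g7 `ramificationIdx_eq_one_of_frame`):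
  `ord_v 2 = ord_{v̄} 2 = 1`, `ord_{v̄} β = 1`, `ord_v β = 0`, `ord_v (1 − β) = 1`, `ord_w β = 0` off `2`;
* §3 normal form: a `γ ∈ K^×` with `ord_w γ` even at every `w ≠ v̄` is `γ = s β^e c²` with `s = ±1`, `e ∈ {0, 1}`
  (`exists_unit_mul_sq_of_forall_two_dvd_log_valuation` of the tree + §1);
* §4 `Stab(√(γ c²)) = Stab(√γ)`, `Stab(√1) = ⊤`;
* §5 **`layerSubgroup_one_eq_stabilizer_geomSqrt_neg`**: for every `κ : ZpExtension K 2` unramified outside `v̄`,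
  `κ⁻¹(2ℤ₂) = Gal(K̄/K₁) = Stab(√(−β))` — the first layer is `K(√−β)`: `κ⁻¹(2ℤ₂)` is open of index `2`, hence `Stab(√γ)` (tree Kummer,
  `exists_eq_stabilizer_geomSqrt_of_index_eq_two`); every `I_w`, `w ≠ v̄`, fixes `√γ`, so `ord_w γ` is even off `v̄` (file 2, every place)
  and `γ ∼ s β^e`; `γ ∼ 1` contradicts the index, `γ ∼ −1` and `γ ∼ β` are RAMIFIED at `v` (file 2: Eisenstein elements `1 + √−1`,
  `1 + √β`), leaving `γ ∼ −β`.
presearch: Washington §13 / Neukirch VI (CFT description of `K*_∞`), Müller arXiv:2002.05647 §1 (p = 2), Lang FDG Ch. 6 Prop. 1.3 — held; the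
CFT named fact `ZpExtension.existsUnique_isUnramifiedOutside_of_split` is NOT used. beyond-print theorem: no.

References: [Washington1997] §13.1; [NeukirchANT1999] Ch. I §7 (7.4), Ch. II §9 (9.6); [Lang1983] Ch. 6 Prop. 1.3; [Cox2013] §7.A;
[SerreLocalFields1979] Ch. I §6 Prop. 17–18.
-/

noncomputable section

open scoped Classical NumberField

set_option linter.dupNamespace false
set_option autoImplicit false

open NumberField IsDedekindDomain Field WeierstrassCurve
open Literature.NumberTheory Literature.NumberTheory.EllipticCurves Literature.NumberTheory.GaloisRepresentations
open Summit.BirchSwinnertonDyer.BirchSwinnertonDyer.Theorems.PrintCf2.AdditiveAtSeven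
open Summit.BirchSwinnertonDyer.BirchSwinnertonDyer.Theorems.PrintCf2.ReductionTypesOverK

namespace Summit.BirchSwinnertonDyer.BirchSwinnertonDyer.Theorems.PrintCf2.FirstLayer

variable {K : Type} [Field K] [NumberField K]

/-! ## §3. Normal form of an element with even valuations off `v̄`: `γ = s β^e c²` -/

section NormalForm

/-- **`K(S, 2)` for `S = {v̄}` is `{±1, ±β}`**: in the frame field (PID, units `±1`), an element `γ ∈ K^×` whose valuation is EVEN at
every place `w ≠ v̄` is `s·β^e·c²` with `s = ±1`, `e ∈ {0, 1}`, `c ∈ K^×` — `β` any integer with `ord_{v̄} β = 1` and a unit elsewhere.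
(Tree `exists_unit_mul_sq_of_forall_two_dvd_log_valuation` applied to `γ β^e`.) [cite: SilvermanAEC2009, Prop. VIII.1.6 and X.1 (the group K(S,2))] -/
theorem exists_eq_sign_mul_pow_mul_sq (hK : IsImaginaryQuadratic K) {θ : K} (hθ : θ ^ 2 = -7)
    {vbar : HeightOneSpectrum (𝓞 K)} {β : 𝓞 K} (hβvbar : vbar.intValuation β = WithZero.exp (-1 : ℤ))
    (hβw : ∀ w : HeightOneSpectrum (𝓞 K), w ≠ vbar → w.intValuation β = 1)
    {γ : K} (hγ : γ ≠ 0) (heven : ∀ w : HeightOneSpectrum (𝓞 K), w ≠ vbar → (2 : ℤ) ∣ WithZero.log (w.valuation K γ)) :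
    ∃ (c : K) (s : 𝓞 K) (e : ℕ), c ≠ 0 ∧ (s = 1 ∨ s = -1) ∧ (e = 0 ∨ e = 1) ∧ γ = ((s * β ^ e : 𝓞 K) : K) * c ^ 2 := by
  haveI := isPrincipalIdealRing_of_sq_eq_neg_seven hK hθ
  have hβ0 : (β : K) ≠ 0 := by
    intro h
    have hb : β = 0 := by exact_mod_cast h
    rw [hb, map_zero] at hβvbar
    exact WithZero.zero_ne_coe hβvbar
  obtain ⟨e, he01, hepar⟩ : ∃ e : ℕ, (e = 0 ∨ e = 1) ∧ (2 : ℤ) ∣ WithZero.log (vbar.valuation K γ) - e := by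
    by_cases h : (2 : ℤ) ∣ WithZero.log (vbar.valuation K γ)
    · exact ⟨0, Or.inl rfl, by simpa using h⟩
    · exact ⟨1, Or.inr rfl, by omega⟩
  have hγ₂0 : γ * (β : K) ^ e ≠ 0 := mul_ne_zero hγ (pow_ne_zero _ hβ0)
  have hβK : ∀ w : HeightOneSpectrum (𝓞 K), w.valuation K (β : K) = w.intValuation β := fun w ↦
    HeightOneSpectrum.valuation_of_algebraMap w β
  have hval : ∀ w : HeightOneSpectrum (𝓞 K), (2 : ℤ) ∣ WithZero.log (w.valuation K (γ * (β : K) ^ e)) := by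
    intro w
    have hvγ : w.valuation K γ ≠ 0 := (Valuation.ne_zero_iff _).mpr hγ
    have hvβ : w.valuation K (β : K) ≠ 0 := (Valuation.ne_zero_iff _).mpr hβ0
    rw [map_mul, map_pow, WithZero.log_mul hvγ (pow_ne_zero _ hvβ), WithZero.log_pow, hβK]
    by_cases hw : w = vbar
    · subst hw
      rw [hβvbar, WithZero.log_exp, smul_neg, nsmul_eq_mul, mul_one, ← sub_eq_add_neg]
      exact hepar
    · rw [hβw w hw, WithZero.log_one, smul_zero, add_zero]
      exact heven w hw
  obtain ⟨u, c₀, hc₀⟩ := NumberFields.exists_unit_mul_sq_of_forall_two_dvd_log_valuation (R := 𝓞 K) hγ₂0 hval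
  obtain ⟨s, hs, hsu⟩ : ∃ s : 𝓞 K, (s = 1 ∨ s = -1) ∧ algebraMap (𝓞 K) K (u : 𝓞 K) = (s : K) := by
    rcases units_eq_one_or_eq_neg_one hK hθ u with hu | hu
    · exact ⟨1, Or.inl rfl, by rw [hu, Units.val_one, map_one]; push_cast; rfl⟩
    · exact ⟨-1, Or.inr rfl, by rw [hu, Units.val_neg, Units.val_one, map_neg, map_one]; push_cast; rfl⟩
  have hc₀0 : c₀ ≠ 0 := by
    rintro rfl
    apply hγ₂0
    rw [hc₀]; ring
  refine ⟨c₀ / (β : K) ^ e, s, e, div_ne_zero hc₀0 (pow_ne_zero _ hβ0), hs, he01, ?_⟩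
  rw [hsu] at hc₀
  push_cast
  field_simp
  linear_combination hc₀

end NormalForm

/-! ## §4. Stabilisers of square roots: square classes, `√1` -/

section Stabilizer

omit [NumberField K] in
/-- `Stab(√(γ c²)) = Stab(√γ)` for `c ≠ 0` (`√(γc²) = ±c√γ` and `c ∈ K` is Galois-fixed). [folklore] -/
theorem stabilizer_geomSqrt_mul_sq {γ₀ c : K} (hc : c ≠ 0) :
    MulAction.stabilizer (absoluteGaloisGroup K) (geomSqrt (γ₀ * c ^ 2)) =
      MulAction.stabilizer (absoluteGaloisGroup K) (geomSqrt γ₀) := by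
  have hsq : geomSqrt (γ₀ * c ^ 2) ^ 2 = (algebraMap K (AlgebraicClosure K) c * geomSqrt γ₀) ^ 2 := by
    rw [geomSqrt_sq, mul_pow, geomSqrt_sq, ← map_pow, ← map_mul, mul_comm]
  have hcA : algebraMap K (AlgebraicClosure K) c ≠ 0 := (map_ne_zero _).mpr hc
  have hfix : ∀ σ : absoluteGaloisGroup K,
      σ • (algebraMap K (AlgebraicClosure K) c * geomSqrt γ₀) = algebraMap K (AlgebraicClosure K) c * σ • geomSqrt γ₀ := by
    intro σ
    rw [absoluteGaloisGroup.smul_def, absoluteGaloisGroup.smul_def, map_mul, AlgEquiv.commutes]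
  ext σ
  simp only [MulAction.mem_stabilizer_iff]
  rcases sq_eq_sq_iff_eq_or_eq_neg.mp hsq with h | h
  · rw [h, hfix]
    exact ⟨fun h1 ↦ mul_left_cancel₀ hcA h1, fun h1 ↦ by rw [h1]⟩
  · rw [h, smul_neg, hfix, neg_inj]
    exact ⟨fun h1 ↦ mul_left_cancel₀ hcA h1, fun h1 ↦ by rw [h1]⟩

omit [NumberField K] in
/-- `Stab(√1) = Γ_K` (`√1 = ±1`). [folklore] -/
theorem stabilizer_geomSqrt_one : MulAction.stabilizer (absoluteGaloisGroup K) (geomSqrt (1 : K)) = ⊤ := by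
  rw [eq_top_iff]
  intro σ _
  rw [MulAction.mem_stabilizer_iff]
  have h1 : geomSqrt (1 : K) * geomSqrt (1 : K) = 1 := by rw [← sq, geomSqrt_sq, map_one]
  rcases mul_self_eq_one_iff.mp h1 with h | h
  · rw [h, absoluteGaloisGroup.smul_def, map_one]
  · rw [h, smul_neg, absoluteGaloisGroup.smul_def, map_one]

end Stabilizer

/-! ## §5. The first layer of every `ℤ₂`-line of the frame field unramified outside `v̄` is `K(√−β)` -/

section Main

/-- **THE FIRST LAYER IS `K(√−β)`.** On a frame (`K` imaginary quadratic with `θ² = −7`, a member `C • W = cm7^{(d)}` — used only for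
`e(v∣2) = e(v̄∣2) = 1` —, `2 = v v̄` with `v ≠ v̄`, `β ∈ 𝓞_K` with `β(1−β) = 2` and `β ∈ v̄`), for EVERY `ℤ₂`-extension `κ` of `K`
unramified outside `v̄`: **`κ⁻¹(2ℤ₂) = Gal(K̄/K₁) = Stab(√−β)`**, i.e. the first layer `K₁` is `K(√−β)`. No class field theory:
Kummer (`H = Stab(√γ)`), parity of `ord_w γ` at every `w ≠ v̄` (all `I_w ≤ ker κ ≤ H`), the normal form `γ ∼ s β^e` of §3, and the
exclusions `γ ∼ 1` (index `2`), `γ ∼ −1`, `γ ∼ β` (RAMIFIED at `v` by file 2's Eisenstein elements). This is memo B15 §1 (C2) as a theorem.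
[cite: Washington1997, §13.1] [cite: Lang1983, Ch. 6 Prop. 1.3] [cite: SerreLocalFields1979, Ch. I §6 Prop. 17–18] -/
theorem layerSubgroup_one_eq_stabilizer_geomSqrt_neg (hK : IsImaginaryQuadratic K) {θ : K} (hθ : θ ^ 2 = -7) {d : ℤ}
    (hd0 : d ≠ 0) (W : WeierstrassCurve ℚ) [W.IsElliptic] {C : VariableChange ℚ} (hC : C • W = cm7.quadraticTwist (d : ℚ))
    {v vbar : HeightOneSpectrum (𝓞 K)} (hv : ((2 : ℕ) : 𝓞 K) ∈ v.asIdeal) (hvbar : ((2 : ℕ) : 𝓞 K) ∈ vbar.asIdeal)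
    (hne : vbar ≠ v) {β : 𝓞 K} (hβ : β * (1 - β) = 2) (hβvbar : β ∈ vbar.asIdeal)
    (κ : ZpExtension K 2) (hκ : κ.IsUnramifiedOutside vbar) :
    κ.layerSubgroup 1 = MulAction.stabilizer (absoluteGaloisGroup K) (geomSqrt (-(β : K))) := by
  -- valuations of `β`
  have h2v := intValuation_two_of_frame hK hθ hd0 W hC hv
  have h2vbar := intValuation_two_of_frame hK hθ hd0 W hC hvbar
  obtain ⟨hβ1, -⟩ := intValuation_vbar h2vbar hβ hβvbar
  obtain ⟨hvβ, hv1β⟩ := intValuation_v hK hθ hv hvbar hne h2v h2vbar hβ hβvbar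
  have hβw : ∀ w : HeightOneSpectrum (𝓞 K), w ≠ vbar → w.intValuation β = 1 := by
    intro w hw
    by_cases h2w : ((2 : ℕ) : 𝓞 K) ∈ w.asIdeal
    · rcases CMPrimes.eq_or_eq_of_two_mem K hK.1 hv hvbar hne h2w with rfl | rfl
      · exact hvβ
      · exact absurd rfl hw
    · exact (intValuation_eq_one_of_two_notMem hβ h2w).1
  have hβ0 : (β : K) ≠ 0 := by
    intro h
    have hb : β = 0 := by exact_mod_cast h
    rw [hb, zero_mul] at hβ
    exact two_ne_zero hβ.symm
  have h21 : (2 : 𝓞 K) * 1 ∈ v.asIdeal := by rw [mul_one]; exact_mod_cast hv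
  -- Kummer: `H = κ⁻¹(2ℤ₂) = Stab(√γ)`
  have hopen : IsOpen ((κ.layerSubgroup 1 : Subgroup (absoluteGaloisGroup K)) : Set (absoluteGaloisGroup K)) :=
    ZpExtension.isOpen_layerSubgroup κ 1
  have hidx : (κ.layerSubgroup 1).index = 2 := by rw [ZpExtension.index_layerSubgroup κ 1, pow_one]
  obtain ⟨γ, hγ0, hHγ⟩ := MasserWustholz1993.exists_eq_stabilizer_geomSqrt_of_index_eq_two K (κ.layerSubgroup 1) hopen hidx
  -- parity at every `w ≠ v̄`
  have hIH : ∀ w : HeightOneSpectrum (𝓞 K), w ≠ vbar → GreenbergSelmer.inertia w ≤ κ.layerSubgroup 1 := fun w hw ↦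
    (hκ w hw).trans (κ.kerSubgroup_le_layerSubgroup 1)
  have heven : ∀ w : HeightOneSpectrum (𝓞 K), w ≠ vbar → (2 : ℤ) ∣ WithZero.log (w.valuation K γ) := fun w hw ↦
    two_dvd_log_valuation_of_inertia_le_stabilizer w hγ0 (hHγ ▸ hIH w hw)
  obtain ⟨c, s, e, hc, hs, he, hγ⟩ := exists_eq_sign_mul_pow_mul_sq hK hθ hβ1 hβw hγ0 heven
  have hH' : κ.layerSubgroup 1 = MulAction.stabilizer (absoluteGaloisGroup K) (geomSqrt (((s * β ^ e : 𝓞 K)) : K)) := by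
    rw [hHγ, hγ, stabilizer_geomSqrt_mul_sq hc]
  have hvne : v ≠ vbar := fun h ↦ hne h.symm
  have hIv : GreenbergSelmer.inertia v ≤ κ.layerSubgroup 1 := hIH v hvne
  rcases he with rfl | rfl <;> rcases hs with rfl | rfl
  · -- `γ ∼ 1`: `H = ⊤`, contradicting index `2`
    exfalso
    have h1 : (((1 * β ^ 0 : 𝓞 K)) : K) = 1 := by push_cast; ring
    rw [hH', h1, stabilizer_geomSqrt_one, Subgroup.index_top] at hidx
    exact absurd hidx (by norm_num)
  · -- `γ ∼ −1`: `K(√−1)/K` is ramified at `v`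
    exfalso
    have h1 : (((-1 * β ^ 0 : 𝓞 K)) : K) = (((-1 : 𝓞 K)) : K) := by push_cast; ring
    rw [hH', h1] at hIv
    exact not_inertia_le_stabilizer_geomSqrt_of_sq_sub_uniformizer v (u := -1) (c := 1) (by push_cast; norm_num) h21
      (intValuation_neg_one_sub_one_sq h2v) hIv
  · -- `γ ∼ β`: `K(√β)/K` is ramified at `v`
    exfalso
    have h1 : (((1 * β ^ 1 : 𝓞 K)) : K) = (β : K) := by push_cast; ring
    rw [hH', h1] at hIv
    exact not_inertia_le_stabilizer_geomSqrt_of_sq_sub_uniformizer v (u := β) (c := 1) hβ0 h21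
      (intValuation_sub_one_sq hv1β) hIv
  · -- `γ ∼ −β`
    rw [hH']
    congr 2
    push_cast
    ring

/-- **COROLLARY (H7-shape): a place `w ≠ v̄` splits completely in the first layer `K₁` iff `D_w` fixes `√−β`**; in particular
`¬ D_w ≤ κ⁻¹(2ℤ₂)` as soon as some element of `D_w` moves `√−β` (the Frobenius at an odd place where `−β` is a non-residue, e.g.
`w₇`: `−β ≡ 3 (mod w₇)` — file 4). [cite: NeukirchANT1999, Ch. I §8 Prop. (8.3)] -/
theorem not_decomp_le_layerSubgroup_one_of_exists_smul_ne (hK : IsImaginaryQuadratic K) {θ : K} (hθ : θ ^ 2 = -7) {d : ℤ}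
    (hd0 : d ≠ 0) (W : WeierstrassCurve ℚ) [W.IsElliptic] {C : VariableChange ℚ} (hC : C • W = cm7.quadraticTwist (d : ℚ))
    {v vbar : HeightOneSpectrum (𝓞 K)} (hv : ((2 : ℕ) : 𝓞 K) ∈ v.asIdeal) (hvbar : ((2 : ℕ) : 𝓞 K) ∈ vbar.asIdeal)
    (hne : vbar ≠ v) {β : 𝓞 K} (hβ : β * (1 - β) = 2) (hβvbar : β ∈ vbar.asIdeal)
    (κ : ZpExtension K 2) (hκ : κ.IsUnramifiedOutside vbar) {w : HeightOneSpectrum (𝓞 K)}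
    (hw : ∃ δ ∈ GreenbergSelmer.decomp w, δ • geomSqrt (-(β : K)) ≠ geomSqrt (-(β : K))) :
    ¬ GreenbergSelmer.decomp w ≤ κ.layerSubgroup 1 := by
  obtain ⟨δ, hδ, hδβ⟩ := hw
  intro hle
  rw [layerSubgroup_one_eq_stabilizer_geomSqrt_neg hK hθ hd0 W hC hv hvbar hne hβ hβvbar κ hκ] at hle
  exact hδβ (MulAction.mem_stabilizer_iff.mp (hle hδ))

end Main

end Summit.BirchSwinnertonDyer.BirchSwinnertonDyer.Theorems.PrintCf2.FirstLayer

end
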